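import Summits.HubbardSuperconductivity.HubbardSuperconductivity.Theorems.LevyLogBootstrapDressHalfFilledKernelTableOfUnique
import Summits.HubbardSuperconductivity.HubbardSuperconductivity.Theorems.LevyLogBootstrapDressHalfFilledKernelXXZBondSum
import HarnessLib

/-!
# Route `LevyLogBootstrap` / `AnisotropyChord`, crux `DressHalfFilled` (stmt-HubbardSuperconductivity-8148), stub 2
# `stub_plaquetteDictionary`: THE XXZ BOND SUM OF KATO'S KERNELS FROM THE PLAQUETTE DATA (W4) — no `U`-window

Support file (`--supports stmt-HubbardSuperconductivity-8148`), continuing `…KernelTableOfUnique`. The spin side of clause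
(d) — `…KernelXXZBond` (one bond of `2J·XXZ(Δ_eff)` is minus the two-plaquette kernel plus an affine diagonal) and
`…KernelXXZBondSum` (summed over the oriented bonds of `(ℤ/M)²`: the entries of `2J · xxzHamiltonian 1 (torusGraph 2 M)
(-1) Δ_eff + k(N_b)`) — is stated in the tree for `U ∈ [2, 4]`. Its only window-dependent inputs are the kernel table and
`μ = μ'`, which `…KernelTableOfUnique` derives from the (W4) uniqueness clauses of `PlaquetteData U`. This file repeats
the two spin-side files with (W4) as hypotheses `h4`, `h2` (proofs verbatim; the torus bookkeeping
`torus_affineBondSum`, `card_up_eq_sum_rev`, `torus_sum_pairs_eq_sum_edgeFinset_complex` is reused from the tree):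

* `plaquetteKernel_rev_eq_spinHalf_of_unique`, `spinBond_xxz_apply_eq_plaquetteKernel_of_unique`,
  `spinBond_xxzΔ_apply_eq_plaquetteKernel_of_unique` (`J ≠ 0`);
* `plaquetteKernel_swap_swap_of_unique`;
* **`plaquetteKernel_bondSum_eq_xxz_of_unique`** (`J ≠ 0`, `M ≥ 3`) — the hypothesis `hbond` of
  `…DictionaryLocality.dictionaryMap_kernel_pullback_of`.

References: H. Yao, W.-F. Tsai, S. A. Kivelson, PRB 76 (2007) 161104(R), eq. (2) [YaoTsaiKivelson2007]; W.-F. Tsai,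
S. A. Kivelson, PRB 73 (2006) 214510, App. A [TsaiKivelson2006]; H. Tasaki (2020), §2.1, §2.4 [Tasaki2020]. No
definition and no named fact is introduced.
-/

noncomputable section

set_option linter.dupNamespace false

namespace Summit.HubbardSuperconductivity.HubbardSuperconductivity.Theorems.LevyLogBootstrap

open Matrix Finset Complex Literature.MathematicalPhysics.QuantumLattice Literature.Probability.LatticeModels
open scoped ComplexOrder

section KernelXXZOfUnique

variable {U : ℝ}
  (h4 : ∀ φ₁ φ₂ : Fock (Orb PlaquetteSite), IsGroundStateInSector (plaquetteHamiltonian U) 4 0 φ₁ →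
    IsGroundStateInSector (plaquetteHamiltonian U) 4 0 φ₂ → ∃ a : ℂ, φ₂ = a • φ₁)
  (h2 : ∀ φ₁ φ₂ : Fock (Orb PlaquetteSite), IsGroundStateInSector (plaquetteHamiltonian U) 2 0 φ₁ →
    IsGroundStateInSector (plaquetteHamiltonian U) 2 0 φ₂ → ∃ a : ℂ, φ₂ = a • φ₁)
include h4 h2

/-! ### One bond -/

/-- Kato's two-plaquette kernel is one XXZ bond (local form), under (W4): for all `a b c d : Fin 2`,
`2J (Sˣ_{ac} Sˣ_{bd} + Sʸ_{ac} Sʸ_{bd}) - V Sᶻ_{ac} Sᶻ_{bd} = -K((ā,b̄),(c̄,d̄)) + [a = c ∧ b = d] · ((Re K(0,0) - V/4) +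
(μ + V/2)(ā + b̄))`. [cite: YaoTsaiKivelson2007, eq. (2)] -/
theorem plaquetteKernel_rev_eq_spinHalf_of_unique (a b c d : Fin 2) :
    (((2 * (plaquettePairCouplings U).J : ℝ) : ℂ)) * (spinX 1 a c * spinX 1 b d + spinY 1 a c * spinY 1 b d) -
        (((plaquettePairCouplings U).V : ℝ) : ℂ) * (SpinOperators.spinZ 1 a c * SpinOperators.spinZ 1 b d) =
      -(plaquetteKernel U (a.rev, b.rev) (c.rev, d.rev)) +
        (if a = c ∧ b = d then
          ((((plaquetteKernel U (0, 0) (0, 0)).re - (plaquettePairCouplings U).V / 4 +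
              ((plaquettePairCouplings U).μ + (plaquettePairCouplings U).V / 2) *
                (((a.rev : ℕ) : ℝ) + ((b.rev : ℕ) : ℝ)) : ℝ) : ℂ))
        else 0) := by
  have hdiag : ∀ n n' : Fin 2, (plaquetteKernel U (n, n') (n, n')).re =
      (plaquetteKernel U (0, 0) (0, 0)).re + (plaquettePairCouplings U).μ * (n : ℕ) +
        (plaquettePairCouplings U).μ * (n' : ℕ) + (plaquettePairCouplings U).V * ((n : ℕ) * (n' : ℕ)) := by
    intro n n'
    rw [plaquetteKernel_diag_decomposition U n n', ← plaquettePairCouplings_mu_symm_of_unique h4 h2]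
  have hd10 : (plaquetteKernel U (1, 0) (1, 0)).re =
      (plaquetteKernel U (0, 0) (0, 0)).re + (plaquettePairCouplings U).μ := by
    rw [hdiag 1 0]; simp
  have hd01 : (plaquetteKernel U (0, 1) (0, 1)).re =
      (plaquetteKernel U (0, 0) (0, 0)).re + (plaquettePairCouplings U).μ := by
    rw [hdiag 0 1]; simp
  have hd11 : (plaquetteKernel U (1, 1) (1, 1)).re =
      (plaquetteKernel U (0, 0) (0, 0)).re + 2 * (plaquettePairCouplings U).μ + (plaquettePairCouplings U).V := by
    rw [hdiag 1 1]; simp; ring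
  have spinRaise_one_apply : ∀ k l : Fin 2, spinRaise 1 k l = if k = 0 ∧ l = 1 then 1 else 0 := by
    intro k l
    rw [spinRaise_apply]
    fin_cases k <;> fin_cases l <;> norm_num
  have spinLower_one_apply : ∀ k l : Fin 2, spinLower 1 k l = if k = 1 ∧ l = 0 then 1 else 0 := by
    intro k l
    rw [spinLower, conjTranspose_apply, spinRaise_one_apply]
    by_cases h : k = 1 ∧ l = 0
    · rw [if_pos ⟨h.2, h.1⟩, if_pos h, star_one]
    · rw [if_neg (fun h' => h ⟨h'.2, h'.1⟩), if_neg h, star_zero]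
  have r0 : (0 : Fin 2).rev = 1 := rfl
  have r1 : (1 : Fin 2).rev = 0 := rfl
  rw [spinX_mul_spinX_add_spinY_mul_spinY, plaquetteKernel_apply_of_unique h4 h2]
  fin_cases a <;> fin_cases b <;> fin_cases c <;> fin_cases d <;>
    simp only [spinRaise_one_apply, spinLower_one_apply, spinZ_one_apply, Fin.isValue, r0, r1, Fin.zero_eta,
      Fin.mk_one, hd10, hd01, hd11, Prod.mk.injEq, Prod.swap_prod_mk, Fin.val_zero, Fin.val_one] <;>
    norm_num <;> ring

/-- Kato's two-plaquette kernel is one XXZ bond, lattice form, under (W4). [cite: YaoTsaiKivelson2007, eq. (2)] -/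
theorem spinBond_xxz_apply_eq_plaquetteKernel_of_unique {Λ : Type*} [Fintype Λ] [DecidableEq Λ]
    {x y : Λ} (hxy : x ≠ y) (σ τ : TensorIndex Λ 2) (h : ∀ z, z ≠ x → z ≠ y → σ z = τ z) :
    ((((2 * (plaquettePairCouplings U).J : ℝ) : ℂ)) • (spinBond 1 0 x y + spinBond 1 1 x y) -
        (((plaquettePairCouplings U).V : ℝ) : ℂ) • spinBond 1 2 x y) σ τ =
      -(plaquetteKernel U ((σ x).rev, (σ y).rev) ((τ x).rev, (τ y).rev)) +
        (if σ = τ then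
          ((((plaquetteKernel U (0, 0) (0, 0)).re - (plaquettePairCouplings U).V / 4 +
              ((plaquettePairCouplings U).μ + (plaquettePairCouplings U).V / 2) *
                ((((σ x).rev : ℕ) : ℝ) + (((σ y).rev : ℕ) : ℝ)) : ℝ) : ℂ))
        else 0) := by
  have hστ : σ = τ ↔ σ x = τ x ∧ σ y = τ y := by
    constructor
    · rintro rfl; exact ⟨rfl, rfl⟩
    · rintro ⟨hx, hy⟩
      funext z
      by_cases hzx : z = x
      · rw [hzx, hx]
      · by_cases hzy : z = y
        · rw [hzy, hy]
        · exact h z hzx hzy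
  rw [if_congr hστ rfl rfl, ← plaquetteKernel_rev_eq_spinHalf_of_unique h4 h2 (σ x) (σ y) (τ x) (τ y)]
  simp only [Matrix.sub_apply, Matrix.smul_apply, Matrix.add_apply, smul_eq_mul, spinBond_apply_of_ne 1 _ hxy,
    if_pos h, spinVec_zero, spinVec_one, spinVec_two]

/-- The literal `Δ_eff` form under (W4) (`J ≠ 0`). [cite: YaoTsaiKivelson2007, eq. (2) and p. 4] -/
theorem spinBond_xxzΔ_apply_eq_plaquetteKernel_of_unique (hJ : (plaquettePairCouplings U).J ≠ 0)
    {Λ : Type*} [Fintype Λ] [DecidableEq Λ] {x y : Λ} (hxy : x ≠ y) (σ τ : TensorIndex Λ 2)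
    (h : ∀ z, z ≠ x → z ≠ y → σ z = τ z) :
    ((((2 * (plaquettePairCouplings U).J : ℝ) : ℂ)) •
        (spinBond 1 0 x y + spinBond 1 1 x y + (((plaquettePairCouplings U).ΔEff : ℝ) : ℂ) • spinBond 1 2 x y)) σ τ =
      -(plaquetteKernel U ((σ x).rev, (σ y).rev) ((τ x).rev, (τ y).rev)) +
        (if σ = τ then
          ((((plaquetteKernel U (0, 0) (0, 0)).re - (plaquettePairCouplings U).V / 4 +
              ((plaquettePairCouplings U).μ + (plaquettePairCouplings U).V / 2) *
                ((((σ x).rev : ℕ) : ℝ) + (((σ y).rev : ℕ) : ℝ)) : ℝ) : ℂ))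
        else 0) := by
  rw [← spinBond_xxz_apply_eq_plaquetteKernel_of_unique h4 h2 hxy σ τ h]
  have hΔ : (((2 * (plaquettePairCouplings U).J : ℝ) : ℂ)) * (((plaquettePairCouplings U).ΔEff : ℝ) : ℂ) =
      -(((plaquettePairCouplings U).V : ℝ) : ℂ) := by
    rw [← Complex.ofReal_mul, ← Complex.ofReal_neg, plaquettePairCouplings_ΔEff]
    congr 1
    field_simp
  rw [smul_add, smul_smul, hΔ, neg_smul, sub_eq_add_neg]

/-! ### Exchange symmetry of the table -/

/-- The table is symmetric under exchanging the two plaquettes of the bond, under (W4):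
`K(κ'.swap, κ.swap) = K(κ', κ)`. [cite: TsaiKivelson2006, App. A (A1)] -/
theorem plaquetteKernel_swap_swap_of_unique (κ' κ : Fin 2 × Fin 2) :
    plaquetteKernel U κ'.swap κ.swap = plaquetteKernel U κ' κ := by
  have hx : plaquetteKernel U (0, 1) (1, 0) = plaquetteKernel U (1, 0) (0, 1) := by
    rw [plaquetteKernel_hop'_eq_neg_J_of_unique h4 h2, plaquetteKernel_hop_eq_neg_J_of_unique h4 h2]
  by_cases h1 : κ' = κ
  · subst h1
    rcases κ' with ⟨k, l⟩
    exact (plaquetteKernel_reflect_of_unique h4 h2 k l).symm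
  · by_cases h3 : κ'.1 ≠ κ'.2 ∧ κ = κ'.swap
    · obtain ⟨hne, rfl⟩ := h3
      rw [Prod.swap_swap]
      rcases κ' with ⟨a, b⟩
      simp only [Prod.swap_prod_mk]
      fin_cases a <;> fin_cases b
      · exact absurd rfl hne
      · exact hx.symm
      · exact hx
      · exact absurd rfl hne
    · rw [plaquetteKernel_eq_zero U _ _ h1 h3, plaquetteKernel_eq_zero U _ _ (fun h => h1 (Prod.swap_injective h))]
      rintro ⟨hne, heq⟩
      refine h3 ⟨fun h => hne h.symm, ?_⟩
      rw [← Prod.swap_swap κ, heq, Prod.swap_swap]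

/-! ### The bond sum -/

/-- **THE DICTIONARY, OPERATOR FORM ON THE SPIN SIDE, under (W4)** (`J(U) ≠ 0`, `M ≥ 3`): the oriented-bond sum of the
two-plaquette kernels over `(ℤ/M)²` is `⟨σ'| 2J · xxzHamiltonian 1 (torusGraph 2 M) (-1) Δ_eff |σ⟩ + [σ' = σ] ·
(2M²(Re K(0,0) - V/4) + 4(μ + V/2) N_b(σ))` — verbatim `plaquetteKernel_bondSum_eq_xxz` with the window replaced by (W4).
[cite: YaoTsaiKivelson2007, eq. (2)] -/
theorem plaquetteKernel_bondSum_eq_xxz_of_unique (hJ : (plaquettePairCouplings U).J ≠ 0)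
    (M : ℕ) [NeZero M] (hM : 3 ≤ M) (σ' σ : TensorIndex (TorusSite 2 M) 2) :
    ∑ x : TorusSite 2 M, ∑ i : Fin 2,
        (if (∀ z, z ≠ x → z ≠ x + Pi.single i 1 → σ' z = σ z) then
          plaquetteKernel U ((σ' x).rev, (σ' (x + Pi.single i 1)).rev) ((σ x).rev, (σ (x + Pi.single i 1)).rev)
        else 0) =
      ((((2 * (plaquettePairCouplings U).J : ℝ) : ℂ)) •
          xxzHamiltonian 1 (torusGraph 2 M) (-1) (plaquettePairCouplings U).ΔEff) σ' σ +
        (if σ' = σ then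
          (((2 * (M : ℝ) ^ 2 * ((plaquetteKernel U (0, 0) (0, 0)).re - (plaquettePairCouplings U).V / 4) +
              4 * ((plaquettePairCouplings U).μ + (plaquettePairCouplings U).V / 2) *
                ((Finset.univ.filter fun x => σ x = 0).card : ℝ) : ℝ) : ℂ))
        else 0) := by
  set C := plaquettePairCouplings U with hC
  set c₀ : ℝ := (plaquetteKernel U (0, 0) (0, 0)).re - C.V / 4 with hc₀
  set c₁ : ℝ := C.μ + C.V / 2 with hc₁
  set g : TorusSite 2 M → ℝ := fun x => (((σ x).rev : ℕ) : ℝ) with hg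
  set F : Sym2 (TorusSite 2 M) → ℂ := Sym2.lift
    ⟨fun x y => if (∀ z, z ≠ x → z ≠ y → σ' z = σ z) then
        plaquetteKernel U ((σ' x).rev, (σ' y).rev) ((σ x).rev, (σ y).rev) else 0,
      fun x y => by
        dsimp only
        have hc : (∀ z, z ≠ x → z ≠ y → σ' z = σ z) ↔ (∀ z, z ≠ y → z ≠ x → σ' z = σ z) :=
          forall_congr' fun z => imp.swap
        rw [if_congr hc rfl rfl, ← plaquetteKernel_swap_swap_of_unique h4 h2 ((σ' y).rev, (σ' x).rev)
          ((σ y).rev, (σ x).rev), Prod.swap_prod_mk, Prod.swap_prod_mk]⟩ with hF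
  set XB : Sym2 (TorusSite 2 M) → Op (TorusSite 2 M) 2 := Sym2.lift
    ⟨fun x y => spinBond 1 0 x y + spinBond 1 1 x y + ((C.ΔEff : ℝ) : ℂ) • spinBond 1 2 x y,
      fun x y => by simp only [spinBond_comm]⟩ with hXB
  set AB : Sym2 (TorusSite 2 M) → ℂ := Sym2.lift
    ⟨fun x y => if σ' = σ then (((c₀ + c₁ * (g x + g y) : ℝ)) : ℂ) else 0, fun x y => by
      simp only [add_comm (g x) (g y)]⟩ with hAB
  have hL : ∑ x : TorusSite 2 M, ∑ i : Fin 2,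
        (if (∀ z, z ≠ x → z ≠ x + Pi.single i 1 → σ' z = σ z) then
          plaquetteKernel U ((σ' x).rev, (σ' (x + Pi.single i 1)).rev) ((σ x).rev, (σ (x + Pi.single i 1)).rev)
        else 0) = ∑ e ∈ (torusGraph 2 M).edgeFinset, F e := by
    rw [← torus_sum_pairs_eq_sum_edgeFinset_complex M hM F]
    simp only [hF, Sym2.lift_mk]
  have hH : ((((2 * C.J : ℝ) : ℂ)) • xxzHamiltonian 1 (torusGraph 2 M) (-1) C.ΔEff) σ' σ =
      -(((2 * C.J : ℝ) : ℂ)) * ∑ e ∈ (torusGraph 2 M).edgeFinset, XB e σ' σ := by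
    rw [Matrix.smul_apply, smul_eq_mul, xxzHamiltonian, Matrix.smul_apply, smul_eq_mul, Matrix.sum_apply]
    push_cast
    ring
  have hedge : ∀ e ∈ (torusGraph 2 M).edgeFinset, F e = -(((2 * C.J : ℝ) : ℂ)) * XB e σ' σ + AB e := by
    intro e he
    induction e using Sym2.ind with
    | h x y =>
      have hxy : x ≠ y := (torusGraph 2 M).ne_of_adj (SimpleGraph.mem_edgeFinset.1 he)
      simp only [Sym2.lift_mk, hF, hXB, hAB]
      by_cases h : ∀ z, z ≠ x → z ≠ y → σ' z = σ z
      · have key := spinBond_xxzΔ_apply_eq_plaquetteKernel_of_unique h4 h2 hJ hxy σ' σ h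
        rw [Matrix.smul_apply, smul_eq_mul, ← hC] at key
        rw [if_pos h, neg_mul, key]
        by_cases hs : σ' = σ
        · rw [if_pos hs, if_pos hs, hs]
          ring
        · rw [if_neg hs, if_neg hs]
          ring
      · have hs : σ' ≠ σ := fun hs => h fun z _ _ => by rw [hs]
        rw [if_neg h, if_neg hs]
        simp only [Matrix.add_apply, Matrix.smul_apply, smul_eq_mul, spinBond_apply_of_ne 1 _ hxy, if_neg h]
        ring
  have hA : ∑ e ∈ (torusGraph 2 M).edgeFinset, AB e =
      if σ' = σ then (((2 * (M : ℝ) ^ 2 * c₀ + 4 * c₁ * ((Finset.univ.filter fun x => σ x = 0).card : ℝ) : ℝ)) : ℂ)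
      else 0 := by
    by_cases hs : σ' = σ
    · rw [if_pos hs, ← card_up_eq_sum_rev σ, ← torus_affineBondSum M hM c₀ c₁ g, Complex.ofReal_sum]
      refine Finset.sum_congr rfl fun e _ => ?_
      induction e using Sym2.ind with
      | h x y => simp only [hAB, Sym2.lift_mk, if_pos hs]
    · rw [if_neg hs]
      refine Finset.sum_eq_zero fun e _ => ?_
      induction e using Sym2.ind with
      | h x y => simp only [hAB, Sym2.lift_mk, if_neg hs]
  rw [hL, Finset.sum_congr rfl hedge, Finset.sum_add_distrib, ← Finset.mul_sum, hA, hH]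

end KernelXXZOfUnique

end Summit.HubbardSuperconductivity.HubbardSuperconductivity.Theorems.LevyLogBootstrap

end
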